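import Literature.NumberTheory.LFunctions.Zhang2022.SkeletonPartThree
import Literature.NumberTheory.LFunctions.Zhang2022.Section9ChangeOfVariables
import HarnessLib

/-!
# Zhang (2022) §9 «Evaluation of Ξ₁₂», typed statement by statement (campaign slice L2-t10)

Y. Zhang, *Discrete mean estimates and the Landau–Siegel zero*, arXiv:2211.02515v1 (2022)
[Zhang2022LandauSiegel] — **an unrefereed manuscript under adjudication. Every `def … : Prop` below is
a CLAIM OF THE MANUSCRIPT (or one printed inference of it), STATED, NOT ASSERTED; typed ≠ discharged.**
Slice: §9 whole, tex `lsz3__2_.tex` L2586–L2689, PDF pp. 51–52 (22 nodes of `plan/DAG.tsv`, ids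
`Z22:(9.1)` … `Z22:(9.8)`; the first line of every docstring is the node id it types).

§9 runs the §8 computation a second time, for `Ξ₁₂` instead of `Ξ₁₁`: by Lemma 8.1,
`Ξ₁₂ = 2Re Θ₁(𝐚₁₂,𝐚₂₂) + o(𝔓)` (9.1) with `𝐚₁₂ = χ(ῑ₃ϰ₃ + ῑ₄ϰ₂)` (9.2); expanding `S_j(𝐚₁₂,𝐚₂₂)`,
applying Lemmas 8.2/8.4 at `x = P₃/(dr)`, "in a way similar to the proof of (8.12)" an integral form,
the change of variables `x → P₂/x`, `x → P₃/x`, the substitution `x = Pᶻ` giving the constants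
`b₃₃, b₄₄, b₃₄, b₄₃` (9.3)–(9.6), then Proposition 7.1 and (9.1) give `Ξ₁₂ = 𝔠₂𝔞𝔓 + o(𝔓)` (9.7),
and "numerical calculation" gives `c₃₃, c₃₄` to within `10⁻⁵` and (9.8) `𝔠₂ < 6.9955`.

| node | decl here | banked / tree decls CITED (never restated) |
|---|---|---|
| `Z22:(9.1)` | — (banked) | `Skeleton.Eq91 c'` (SkeletonMeanValue), kernel edge `Skeleton.eq91_of` (SkeletonReductions) |
| `Z22:(9.2)` | `a22AsPrinted` | `Skeleton.a12`, `Skeleton.a22` (SkeletonMeanValue; AMBIGUITY recorded there and here) |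
| `Z22:§9.u001` | `Step9u001` | `Skeleton.Sj`, `lamZero`, `xiZero`, `vk2`, `vk3`, `betaJ` |
| `Z22:§9.u002`, `u003` | `Step9u002`, `Step9u003` (+ inferences `Ded9u002`, `Ded9u003`) | `Skeleton.Lemma82/Lemma84/frakfW/frakgW/PiW`; `Lemma82.lemma_8_2_varkappa_printed` |
| `Z22:§9.u004` | `int9main`, `int9tail`, `Step9u004` (literal), `Step9u004r` (+ `Ded9u004`) | `S811g` (Section9ChangeOfVariables) |
| `Z22:§9.u005` | `int9cov`, `Step9u005` (+ `Ded9u005`) | `S812g`, `S811g_eq_S812g` |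
| `Z22:§9.u006` | `wsum9`, `coeff97`, `Step9u006`, `Step9u006c` (+ `Ded9u006`, `Ded9u006c`) | `b33 b44 b34 b43 b34c b43c`, `Theta1Coeff9`, `weighted_sum_S911_main`, `prefactor_95_96` |
| `Z22:(9.3)`–`(9.6)` | `Eq93`, `Eq94`, `Eq95`, `Eq96` | `b33`, `b44`, `b34`/`b34c`, `b43`/`b43c` (Section18Defs) |
| `Z22:§9.u007` | `Step9u007`, `Step9u007c` (+ `Ded9u007`) | `Skeleton.Theta1`, `Skeleton.Prop71` |
| `Z22:(9.7)` | — (banked); variant `Eval97c` (+ `Ded97last`, `Ded97lastc`) | `Skeleton.Eval97 c'`, `Skeleton.Ded97`, `Skeleton.eval97_of` |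
| `Z22:§9.u008`–`u012` | `Step9u008` … `Step9u012` | `frakc2`, `c33`, `c44`, `c34`, `c43` (Section18Defs) |
| `Z22:§9.u013`, `u014` | `Step9u013`, `Step9u014`, `Step9u014c` (+ `Ded98`) | certificates `c33_re_bounds`, `c33_im`, `c34_re_bounds`, `c34_im_bounds`, `c34c_re_bounds`, `c34c_im_bounds` (Section18Certificate) |
| `Z22:(9.8)` | — (banked) | `Ineq98` / `Ineq98c` (Section18Defs), TRUE in the tree: `ineq98`, `ineq98c` |

Conventions (skel/INTERFACE.md §3, binding): uniform claims are `Skeleton.ForAllLarge fun D _ χ => …`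
with Assumption (A) `Skeleton.AssumptionA D χ` as an antecedent where the manuscript works under (A);
"`= main + o(α)`" ↦ `∀ ε > 0, ForAllLarge (… ‖lhs − main‖ ≤ ε * Skeleton.alpha D)`, "`+ o(1)`" ↦
`≤ ε`, "`+ o(𝔓)`" ↦ `≤ ε * frakP D`, "`+ O(𝓛⁻⁶)`" ↦ `∃ C, … ≤ C * (Skeleton.ell D ^ 6)⁻¹`; norms, not
real parts; the constant `c′` of (2.13) is the explicit parameter `(c' : ℝ)`; all `S_j`-sums are the
finite sums of `Skeleton.Sj` (ranges `Finset.Ico 1 (Skeleton.Nsupp D)`, (7.2)). The rounding symbol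
`ε` of the manuscript ("a complex number satisfying `|ε| < 10⁻⁵`, not necessarily the same in each
occurrence", §8 p. 50, tex L2570) is typed as `∃ e : ℂ, ‖e‖ < 10⁻⁵ ∧ …`.

AMBIGUITIES typed literally AND in the alternative reading (flagged in the docstrings, `GAP?` lines on
the cell STATUS board): (i) (9.2) prints `a₂₂(n) = conj a₂₁(n)` — the next display uses `conj a₁₂(n)`
(banked `Skeleton.a22`); (ii) the display at tex L2614 carries a stray `Σ_{r<D}` in front of an
`r`-free integral (`Step9u004` literal, `Step9u004r` without it); (iii) (9.5)–(9.6) print the prefactor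
`1/((0.504)(0.498)π)` whereas the preceding display has `(log P₂)(log P₃) = (0.5 − o(1))(0.498)log²P`
(tree: `prefactor_95_96`, `weighted_sum_S911_main`) — every statement in which `b₃₄, b₄₃` enter is typed
with the printed `b34/b43` and, suffixed `c`, with `b34c/b43c`.

Inference decls `Ded9…` type the manuscript's individual "Hence / By … / Thus / It follows" steps of §9
as named implications between the step claims; together they refine the coarse skeleton proof node
`Skeleton.Ded97 c' : Eq91 → Prop71 → Lemma82 → Lemma83 → Lemma84 → Eval97` (SkeletonPartTwo) — the
edge `ded97_of_<chain>` is sz-skel's, the proofs are discharger work; nothing here is proved.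

Statement-only file: no `theorem`, no `instance`, no `notation`; 0 new Literature facts (external inputs
are the manuscript's own claims or plan/FACT-LIST.md rows). WHAT THIS IS NOT: any claim about Theorems
1–2 of the manuscript or about Landau–Siegel zeros; the failing inequality of record is elsewhere
((8.24) p. 50 / §18 p. 99, tree `Ineq824`, `Skeleton.Margin232`).

## References

* Y. Zhang, arXiv:2211.02515v1 (2022), §9 pp. 51–52, with §7 Prop. 7.1 p. 33, §8 Lemmas 8.1–8.4
  pp. 42–47, (8.10)–(8.12) p. 48, §8 p. 50 (the `ε` convention). [cite: Zhang2022LandauSiegel, §9]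
-/

noncomputable section

open Complex Real ComplexConjugate

namespace Literature.NumberTheory.LFunctions.Zhang2022.Section9Statements

/-! ## (9.1)–(9.2): the reduction to `Θ₁(𝐚₁₂,𝐚₂₂)` and the sequences -/

section Sequences

variable {D : ℕ} [NeZero D] (χ : DirichletCharacter ℂ D)

/-- `Z22:(9.2)` OBJECT (the printed definiens of `a₂₂`). The display reads
"`a₁₂(n) = χ(n)(ῑ₃ϰ₃(n) + ῑ₄ϰ₂(n))`, `a₂₂(n) = conj(a₂₁(n))`" — `a₁₂` is BANKED verbatim as
`Skeleton.a12 χ` (with `Skeleton.vk2/vk3` = `ϰ₂, ϰ₃` of (8.6) and `iota3/iota4` of (2.26)); this decl is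
the LITERAL printed `a₂₂`, i.e. `conj a₂₁(n)` with `a₂₁` of (8.8) (`Skeleton.a21`). AMBIGUITY: the very
next display (`Z22:§9.u001`) expands the `n`-factor of `S_j(𝐚₁₂,𝐚₂₂)` as
`χ(n)(ι₃ϰ̄₃(drn) + ι₄ϰ̄₂(drn))`, which is `conj a₁₂(drn)` (χ real), not `conj a₂₁(drn)`; the banked
`Skeleton.a22 χ n := conj (Skeleton.a12 χ n)` adopts that reading (cross-confirmed typo, sz-ref-d tier-2
note on SkeletonMeanValue), and every claim below is stated over `Skeleton.a22`. (`Z22:(9.1)` itself is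
BANKED: `Skeleton.Eq91 c'`, with the kernel edge `Skeleton.eq91_of : Prop22i → Lemma23 → Lemma81 → Eq91`.)
[cite: Zhang2022LandauSiegel, §9 (9.2) p.51, tex L2594] -/
def a22AsPrinted (n : ℕ) : ℂ := conj (Skeleton.a21 χ n)

end Sequences

/-! ## The expansion of `S_j(𝐚₁₂,𝐚₂₂)` and the two applications of Lemmas 8.2/8.4 -/

section Expansion

variable (c' : ℝ)

/-- `Z22:§9.u001` CLAIM ("Hence"): for `1 ≤ j ≤ 3`,
`S_j(𝐚₁₂,𝐚₂₂) = Σ_d Σ_r |χ(d)||μχ(r)|λ₀ⱼ(dr)/(drφ(r)) · (Σ_m χ(m)(ῑ₃ϰ₃(drm) + ῑ₄ϰ₂(drm))/m^{1−β_j})`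
`× (Σ_n χ(n)(ι₃ϰ̄₃(drn) + ι₄ϰ̄₂(drn))ξ₀ⱼ(n;d,r)/n)` — the definition of `S_j` (Prop. 7.1,
`Skeleton.Sj`) with `𝐚₁₂, 𝐚₂₂` inserted and `χ(drm) = χ(d)χ(r)χ(m)`, `χ(d)² = |χ(d)|`,
`|μ(r)|χ(r)² = |μχ(r)|` used (χ real); all four sums are the finite sums of `Skeleton.Sj`
(ranges `[1, ⌈PT⁻²⌉)`, (7.2)). An identity for every quadratic `χ`; no (A) needed.
[cite: Zhang2022LandauSiegel, §9 display after (9.2) p.51, tex L2598] -/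
def Step9u001 : Prop :=
  Skeleton.ForAllLarge fun D _ χ => ∀ j ∈ ({1, 2, 3} : Finset ℕ),
    Skeleton.Sj c' D j (Skeleton.a12 χ) (Skeleton.a22 χ) =
      ∑ d ∈ Finset.Ico 1 (Skeleton.Nsupp D), ∑ r ∈ Finset.Ico 1 (Skeleton.Nsupp D),
        (‖χ (d : ZMod D)‖ : ℂ) * (‖(ArithmeticFunction.moebius r : ℂ) * χ (r : ZMod D)‖ : ℂ) *
            Skeleton.lamZero c' D j (d * r) / ((d * r : ℕ) * (Nat.totient r : ℂ)) *
          (∑ m ∈ Finset.Ico 1 (Skeleton.Nsupp D),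
            χ (m : ZMod D) * (conj iota3 * Skeleton.vk3 D (d * r * m) +
              conj iota4 * Skeleton.vk2 D (d * r * m)) / (m : ℂ) ^ (1 - Skeleton.betaJ c' D j)) *
          (∑ n ∈ Finset.Ico 1 (Skeleton.Nsupp D),
            χ (n : ZMod D) * (iota3 * conj (Skeleton.vk3 D (d * r * n)) +
              iota4 * conj (Skeleton.vk2 D (d * r * n))) * Skeleton.xiZero c' D j n d r / (n : ℂ))

/-- `Z22:§9.u002` CLAIM ("By Lemma 8.2 and 8.4, for `dr < P₃/T`"):
`Σ_m χ(m)ϰ₃(drm)/m^{1−β_j} = (L′(1,χ)/log P₃)𝔣_{j6}(P₃/dr) + O(𝓛⁻⁶)` — Lemma 8.2 at `x = P₃/(dr)`,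
`μ = 6` (`𝔣_{j6}` = `Skeleton.frakfW c' D j 6`; the `m`-sum is that of `S_j`, the summand vanishing
for `drm ≥ P₃`). Under (A), as all of §§7–9. Cf. the tree's PROVED general-level form
`Lemma82.lemma_8_2_varkappa_printed` (error `C/(𝓛⁶ log P₃)`, sharper than printed).
[cite: Zhang2022LandauSiegel, §9 p.51, tex L2606] -/
def Step9u002 : Prop :=
  ∃ C : ℝ, Skeleton.ForAllLarge fun D _ χ => Skeleton.AssumptionA D χ →
    ∀ j ∈ ({1, 2, 3} : Finset ℕ), ∀ d r : ℕ, 1 ≤ d → 1 ≤ r →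
      ((d * r : ℕ) : ℝ) < Skeleton.P3 D / Skeleton.bigT D →
        ‖(∑ m ∈ Finset.Ico 1 (Skeleton.Nsupp D),
              χ (m : ZMod D) * Skeleton.vk3 D (d * r * m) / (m : ℂ) ^ (1 - Skeleton.betaJ c' D j)) -
            deriv χ.LFunction 1 / (Real.log (Skeleton.P3 D) : ℂ) *
              Skeleton.frakfW c' D j 6 (Skeleton.P3 D / ((d * r : ℕ) : ℝ))‖ ≤
          C * (Skeleton.ell D ^ 6)⁻¹

/-- `Z22:§9.u003` CLAIM ("By Lemma 8.2 and 8.4, for `dr < P₃/T`"):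
`Σ_n χ(n)ϰ̄₃(drn)ξ₀ⱼ(n;d,r)/n = (L′(1,χ)Π(d,r)/log P₃)𝔤_{j6}(P₃/dr) + O(𝓛⁻⁶)` — Lemma 8.4 at
`x = P₃/(dr)`, `μ = 6` (`Π(d,r)` = `Skeleton.PiW χ d r` of Lemma 8.3, `𝔤_{j6}` = `Skeleton.frakgW c' D j 6`,
`ξ₀ⱼ` = `Skeleton.xiZero`; the `n`-sum is that of `S_j`). Under (A).
[cite: Zhang2022LandauSiegel, §9 p.51, tex L2610] -/
def Step9u003 : Prop :=
  ∃ C : ℝ, Skeleton.ForAllLarge fun D _ χ => Skeleton.AssumptionA D χ →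
    ∀ j ∈ ({1, 2, 3} : Finset ℕ), ∀ d r : ℕ, 1 ≤ d → 1 ≤ r →
      ((d * r : ℕ) : ℝ) < Skeleton.P3 D / Skeleton.bigT D →
        ‖(∑ n ∈ Finset.Ico 1 (Skeleton.Nsupp D),
              χ (n : ZMod D) * conj (Skeleton.vk3 D (d * r * n)) * Skeleton.xiZero c' D j n d r /
                (n : ℂ)) -
            deriv χ.LFunction 1 * Skeleton.PiW χ d r / (Real.log (Skeleton.P3 D) : ℂ) *
              Skeleton.frakgW c' D j 6 (Skeleton.P3 D / ((d * r : ℕ) : ℝ))‖ ≤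
          C * (Skeleton.ell D ^ 6)⁻¹

/-- `Z22:§9.u002` INFERENCE (the manuscript's "By Lemma 8.2 …"): Lemma 8.2 ⇒ `Step9u002`.
Refines `Skeleton.Ded97 c'` (use of `Lemma82`). CLAIM (an implication, stated not proved).
[cite: Zhang2022LandauSiegel, §9 p.51, tex L2605–L2608] -/
def Ded9u002 : Prop := Skeleton.Lemma82 c' → Step9u002 c'

/-- `Z22:§9.u003` INFERENCE (the manuscript's "By Lemma … 8.4"): Lemma 8.4 ⇒ `Step9u003`.
Refines `Skeleton.Ded97 c'` (use of `Lemma84`; `Lemma83` enters only through `Π(d,r)` and the proof of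
Lemma 8.4). CLAIM. [cite: Zhang2022LandauSiegel, §9 p.51, tex L2605–L2612] -/
def Ded9u003 : Prop := Skeleton.Lemma84 c' → Step9u003 c'

end Expansion

/-! ## "In a way similar to the proof of (8.12)": the integral form and the change of variables -/

section Integrals

variable (c' : ℝ)

/-- `Z22:§9.u004` OBJECT: the first integral of the display at tex L2614,
`∫₁^{P₃} (ῑ₃𝔣_{j6}(P₃/x)/log P₃ + ῑ₄𝔣_{j7}(P₂/x)/log P₂)(ι₃𝔤_{j6}(P₃/x)/log P₃ + ι₄𝔤_{j7}(P₂/x)/log P₂) dx/x`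
(`𝔣_{jμ}, 𝔤_{jμ}` = `Skeleton.frakfW/frakgW`, `P₂, P₃` of (2.21) = `Skeleton.P2/P3`). It is the first
term of `S811g ῑ₄ ῑ₃ ι₄ ι₃ 𝔣_{j7} 𝔣_{j6} 𝔤_{j7} 𝔤_{j6}` (Section9ChangeOfVariables) at the scales
`(P₂, P₃)`. [cite: Zhang2022LandauSiegel, §9 p.51, tex L2614–L2615] -/
def int9main (D : ℕ) (j : ℕ) : ℂ :=
  ∫ x in (1 : ℝ)..Skeleton.P3 D,
    (conj iota3 * Skeleton.frakfW c' D j 6 (Skeleton.P3 D / x) / (Real.log (Skeleton.P3 D) : ℂ) +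
        conj iota4 * Skeleton.frakfW c' D j 7 (Skeleton.P2 D / x) / (Real.log (Skeleton.P2 D) : ℂ)) *
      (iota3 * Skeleton.frakgW c' D j 6 (Skeleton.P3 D / x) / (Real.log (Skeleton.P3 D) : ℂ) +
        iota4 * Skeleton.frakgW c' D j 7 (Skeleton.P2 D / x) / (Real.log (Skeleton.P2 D) : ℂ)) /
      (x : ℂ)

/-- `Z22:§9.u004` OBJECT: the second ("tail") integral of the display at tex L2614,
`(log P₂)⁻² ∫_{P₃}^{P₂} 𝔣_{j7}(P₂/x)𝔤_{j7}(P₂/x) dx/x` (without the factor `|ι₄|²𝔞`).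
[cite: Zhang2022LandauSiegel, §9 p.51, tex L2616] -/
def int9tail (D : ℕ) (j : ℕ) : ℂ :=
  (∫ x in Skeleton.P3 D..Skeleton.P2 D,
      Skeleton.frakfW c' D j 7 (Skeleton.P2 D / x) * Skeleton.frakgW c' D j 7 (Skeleton.P2 D / x) /
        (x : ℂ)) / (Real.log (Skeleton.P2 D) : ℂ) ^ 2

/-- `Z22:§9.u004` CLAIM, LITERAL reading ("Thus, in a way similar to the proof of (8.12), we deduce
that"): `S_j(𝐚₁₂,𝐚₂₂) = 𝔞 Σ_{r<D} ∫₁^{P₃}(…)(…)dx/x + |ι₄|²𝔞(log P₂)⁻²∫_{P₃}^{P₂} 𝔣_{j7}(P₂/x)𝔤_{j7}(P₂/x)dx/x + o(α)`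
— WITH the printed `Σ_{r<D}` in front of the (`r`-free) first integral, i.e. `#{1 ≤ r < D}` copies of it.
AMBIGUITY: this literal reading is incompatible with the next display (`Z22:§9.u005`, no `Σ`) and with
the §8 model (8.11) it imitates; the intended reading is `Step9u004r` (the stray `Σ_{r<D}` dropped — so
read by the tree's `Section9ChangeOfVariables`, whose `S811g_eq_S812g` is exactly u004r ⇒ u005). `GAP?`
posted; the chain decls below use `Step9u004r`. `𝔞` = `Skeleton.frakA χ` (2.31), `α` = `Skeleton.alpha D`.
[cite: Zhang2022LandauSiegel, §9 pp.51, tex L2613–L2618] -/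
def Step9u004 : Prop :=
  ∀ ε : ℝ, 0 < ε → Skeleton.ForAllLarge fun D _ χ => Skeleton.AssumptionA D χ →
    ∀ j ∈ ({1, 2, 3} : Finset ℕ),
      ‖Skeleton.Sj c' D j (Skeleton.a12 χ) (Skeleton.a22 χ) -
          (Skeleton.frakA χ : ℂ) * ((∑ _r ∈ Finset.Ico 1 D, int9main c' D j) +
            (Complex.normSq iota4 : ℂ) * int9tail c' D j)‖ ≤ ε * Skeleton.alpha D

/-- `Z22:§9.u004` CLAIM, reading (r) = the display at tex L2614 WITHOUT the stray `Σ_{r<D}`: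
`S_j(𝐚₁₂,𝐚₂₂) = 𝔞∫₁^{P₃}(ῑ₃𝔣_{j6}(P₃/x)/log P₃ + ῑ₄𝔣_{j7}(P₂/x)/log P₂)(ι₃𝔤_{j6}(P₃/x)/log P₃ + ι₄𝔤_{j7}(P₂/x)/log P₂)dx/x`
`+ |ι₄|²𝔞(log P₂)⁻²∫_{P₃}^{P₂}𝔣_{j7}(P₂/x)𝔤_{j7}(P₂/x)dx/x + o(α)` ((8.11) with `(P₁,P₂;1,ι₂) ↦ (P₂,P₃;ῑ₄,ῑ₃)`).
See `Step9u004` for the literal reading. [cite: Zhang2022LandauSiegel, §9 p.51, tex L2613–L2618] -/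
def Step9u004r : Prop :=
  ∀ ε : ℝ, 0 < ε → Skeleton.ForAllLarge fun D _ χ => Skeleton.AssumptionA D χ →
    ∀ j ∈ ({1, 2, 3} : Finset ℕ),
      ‖Skeleton.Sj c' D j (Skeleton.a12 χ) (Skeleton.a22 χ) -
          (Skeleton.frakA χ : ℂ) * (int9main c' D j + (Complex.normSq iota4 : ℂ) * int9tail c' D j)‖ ≤
        ε * Skeleton.alpha D

/-- `Z22:§9.u004` INFERENCE ("Thus, in a way similar to the proof of (8.12), we deduce that"): from the
expansion `Step9u001`, the two `P₃`-level applications `Step9u002/u003`, and Lemmas 8.2/8.4 (for the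
`P₂`-level applications `Σ_mχ(m)ϰ₂(drm)m^{β_j−1}`, `Σ_nχ(n)ϰ̄₂(drn)ξ₀ⱼ/n` of §8 p.47, tex L2424/L2433
— nodes of slice L2-t8, not restated) the integral form `Step9u004r`; inside, as in §8: the identity
(8.10) (PROVED in the tree: `sum_squarefree_divisors_PiLocal`, Section8ArithmeticIdentity),
`λ₀ⱼ(n) = φ(n)²/n² + O(α₁)` and `Σ_{n<x}|χ(n)|φ(n)/n² = (6/π²)∏_{q∣D}q/(q+1)·log x + O(log 𝓛)`
"[T, 1.2.12]" (nodes `Z22:§8.u046–u048` of L2-t8; FACT-CANDIDATE F2 of the L2 lead), then partial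
integration. Refines `Skeleton.Ded97 c'` (the step "(9.2)–Lemma 8.4 ⇒ integral form"). CLAIM.
[cite: Zhang2022LandauSiegel, §9 p.51, tex L2613; §8 p.48, tex L2437–L2466] -/
def Ded9u004 : Prop :=
  Step9u001 c' → Step9u002 c' → Step9u003 c' → Skeleton.Lemma82 c' → Skeleton.Lemma84 c' →
    Step9u004r c'

/-- `Z22:§9.u005` OBJECT: the four-integral form after "the change of variables `x → P₂/x` or `x → P₃/x`"
(tex L2620), without `𝔞` and `o(α)`:
`|ι₃|²(log P₃)⁻²∫₁^{P₃}𝔣_{j6}𝔤_{j6}dx/x + |ι₄|²(log P₂)⁻²∫₁^{P₂}𝔣_{j7}𝔤_{j7}dx/x`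
`+ ῑ₃ι₄((log P₂)(log P₃))⁻¹∫₁^{P₃}𝔣_{j6}(x)𝔤_{j7}(P^{0.002}T^{−10}x)dx/x + ῑ₄ι₃((log P₂)(log P₃))⁻¹∫₁^{P₃}𝔣_{j7}(P^{0.002}T^{−10}x)𝔤_{j6}(x)dx/x`,
the scale ratio written AS PRINTED `P^{0.002}T^{−10}` (`= P₂/P₃` by (2.21); `Skeleton.bigP/bigT`). This is
`S812g ῑ₄ ῑ₃ ι₄ ι₃ 𝔣_{j7} 𝔣_{j6} 𝔤_{j7} 𝔤_{j6}` at scales `(P₂, P₃)` up to that identification.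
[cite: Zhang2022LandauSiegel, §9 p.51, tex L2620–L2626] -/
def int9cov (D : ℕ) (j : ℕ) : ℂ :=
  (Complex.normSq iota3 : ℂ) / (Real.log (Skeleton.P3 D) : ℂ) ^ 2 *
      (∫ x in (1 : ℝ)..Skeleton.P3 D,
        Skeleton.frakfW c' D j 6 x * Skeleton.frakgW c' D j 6 x / (x : ℂ)) +
    (Complex.normSq iota4 : ℂ) / (Real.log (Skeleton.P2 D) : ℂ) ^ 2 *
      (∫ x in (1 : ℝ)..Skeleton.P2 D,
        Skeleton.frakfW c' D j 7 x * Skeleton.frakgW c' D j 7 x / (x : ℂ)) +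
    conj iota3 * iota4 / ((Real.log (Skeleton.P2 D) : ℂ) * (Real.log (Skeleton.P3 D) : ℂ)) *
      (∫ x in (1 : ℝ)..Skeleton.P3 D,
        Skeleton.frakfW c' D j 6 x *
          Skeleton.frakgW c' D j 7 (Skeleton.bigP D ^ (0.002 : ℝ) / Skeleton.bigT D ^ 10 * x) /
          (x : ℂ)) +
    conj iota4 * iota3 / ((Real.log (Skeleton.P2 D) : ℂ) * (Real.log (Skeleton.P3 D) : ℂ)) *
      (∫ x in (1 : ℝ)..Skeleton.P3 D,
        Skeleton.frakfW c' D j 7 (Skeleton.bigP D ^ (0.002 : ℝ) / Skeleton.bigT D ^ 10 * x) *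
          Skeleton.frakgW c' D j 6 x / (x : ℂ))

/-- `Z22:§9.u005` CLAIM ("It follows, by the change of variables `x → P₂/x` or `x → P₃/x`, that …,
since `P₂/P₃ = P^{0.002}T^{−10}`"): `S_j(𝐚₁₂,𝐚₂₂) = 𝔞·int9cov + o(α)`, i.e.
`S_j = 𝔞|ι₃|²(log P₃)⁻²∫₁^{P₃}𝔣_{j6}𝔤_{j6}/x + 𝔞|ι₄|²(log P₂)⁻²∫₁^{P₂}𝔣_{j7}𝔤_{j7}/x + 𝔞ῑ₃ι₄(…)⁻¹∫… + 𝔞ῑ₄ι₃(…)⁻¹∫… + o(α)`.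
[cite: Zhang2022LandauSiegel, §9 p.51, tex L2619–L2626] -/
def Step9u005 : Prop :=
  ∀ ε : ℝ, 0 < ε → Skeleton.ForAllLarge fun D _ χ => Skeleton.AssumptionA D χ →
    ∀ j ∈ ({1, 2, 3} : Finset ℕ),
      ‖Skeleton.Sj c' D j (Skeleton.a12 χ) (Skeleton.a22 χ) - (Skeleton.frakA χ : ℂ) * int9cov c' D j‖ ≤
        ε * Skeleton.alpha D

/-- `Z22:§9.u005` INFERENCE (the change of variables): `Step9u004r ⇒ Step9u005`. The underlying
identity of the displayed integrals is PROVED in the tree for arbitrary continuous profiles and scales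
(`S811g_eq_S812g`, Section9ChangeOfVariables; `integral_comp_div_inv`). Refines `Skeleton.Ded97 c'`.
CLAIM. [cite: Zhang2022LandauSiegel, §9 p.51, tex L2619] -/
def Ded9u005 : Prop := Step9u004r c' → Step9u005 c'

end Integrals

/-! ## (9.3)–(9.6): the constants `b₃₃, b₄₄, b₃₄, b₄₃` and the substitution `x = Pᶻ` -/

section Constants

variable (c' : ℝ)

/-- `Z22:(9.3)` CLAIM (definitional display): "`b₃₃ = (0.498²π)⁻¹∫₀^{0.498}(½𝔣𝔣₁₆(z)𝔤𝔥₁₆(z) + 2𝔣𝔣₂₆(z)𝔤𝔥₂₆(z) + (3/2)𝔣𝔣₃₆(z)𝔤𝔥₃₆(z))dz`"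
with the profiles `𝔣𝔣_{jμ}, 𝔤𝔥_{jμ}` of (8.13)–(8.18) (`ff16 … gh36`, Section8Defs). BANKED as the real
definition `b33` (Section18Defs); typed here as the equation "banked object = printed right side" so
the printed constants are auditable in this slice (it holds by `rfl`; nothing to discharge).
[cite: Zhang2022LandauSiegel, §9 (9.3) p.52, tex L2632] -/
def Eq93 : Prop :=
  b33 = ((1 / (0.498 ^ 2 * π) : ℝ) : ℂ) *
    ∫ z in (0 : ℝ)..0.498,
      (1 / 2 * (ff16 z * gh16 z) + 2 * (ff26 z * gh26 z) + 3 / 2 * (ff36 z * gh36 z))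

/-- `Z22:(9.4)` CLAIM (definitional display): "`b₄₄ = b₂₂`" (`b22` of (8.20), Section8Defs; banked
`b44 := b22`, Section18Defs; holds by `rfl`). [cite: Zhang2022LandauSiegel, §9 (9.4) p.52, tex L2635] -/
def Eq94 : Prop := b44 = b22

/-- `Z22:(9.5)` CLAIM (definitional display), AS PRINTED:
"`b₃₄ = ((0.504)(0.498)π)⁻¹∫₀^{0.498}(½𝔣𝔣₁₇(z+0.002)𝔤𝔥₁₆(z) + 2𝔣𝔣₂₇(z+0.002)𝔤𝔥₂₆(z) + (3/2)𝔣𝔣₃₇(z+0.002)𝔤𝔥₃₆(z))dz`"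
(banked `b34`, Section18Defs, printed prefactor; holds by `rfl`). AMBIGUITY (prefactor): the substitution
`x = Pᶻ` in the preceding display produces `((log P₂)(log P₃)/log²P · π)⁻¹ = ((0.5)(0.498)π)⁻¹`
(`0.504 = log P₁/log P` does not occur in §9) — second reading `b34c` (Section18Defs), `b34c = 1.008·b34`
(`prefactor_95_96`, `weighted_sum_S911_main`, Section9ChangeOfVariables); the printed numerical value of
`c₃₄` (`Z22:§9.u014`) is the `b34c`-reading's. Both readings satisfy (9.8) in the tree (`ineq98`, `ineq98c`).
[cite: Zhang2022LandauSiegel, §9 (9.5) p.52, tex L2638–L2640] -/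
def Eq95 : Prop :=
  b34 = ((1 / (0.504 * 0.498 * π) : ℝ) : ℂ) *
    ∫ z in (0 : ℝ)..0.498,
      (1 / 2 * (ff17 (z + 0.002) * gh16 z) + 2 * (ff27 (z + 0.002) * gh26 z) +
        3 / 2 * (ff37 (z + 0.002) * gh36 z))

/-- `Z22:(9.6)` CLAIM (definitional display), AS PRINTED:
"`b₄₃ = ((0.504)(0.498)π)⁻¹∫₀^{0.498}(½𝔣𝔣₁₆(z)𝔤𝔥₁₇(z+0.002) + 2𝔣𝔣₂₆(z)𝔤𝔥₂₇(z+0.002) + (3/2)𝔣𝔣₃₆(z)𝔤𝔥₃₇(z+0.002))dz`"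
(banked `b43`; second reading `b43c`, see `Eq95`; holds by `rfl`).
[cite: Zhang2022LandauSiegel, §9 (9.6) p.52, tex L2642–L2644] -/
def Eq96 : Prop :=
  b43 = ((1 / (0.504 * 0.498 * π) : ℝ) : ℂ) *
    ∫ z in (0 : ℝ)..0.498,
      (1 / 2 * (ff16 z * gh17 (z + 0.002)) + 2 * (ff26 z * gh27 (z + 0.002)) +
        3 / 2 * (ff36 z * gh37 (z + 0.002)))

/-- `Z22:§9.u006` OBJECT: the weighted sum `(2α)⁻¹S₁(𝐚₁₂,𝐚₂₂) + 2α⁻¹S₂(𝐚₁₂,𝐚₂₂) + (3/(2α))S₃(𝐚₁₂,𝐚₂₂)`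
of the display at tex L2627 (the weights of Prop. 7.1; `= Skeleton.mainMV c' D 𝐚₁₂ 𝐚₂₂ / 𝔓`).
[cite: Zhang2022LandauSiegel, §9 p.51, tex L2627–L2628] -/
def wsum9 {D : ℕ} [NeZero D] (χ : DirichletCharacter ℂ D) : ℂ :=
  1 / (2 * (Skeleton.alpha D : ℂ)) * Skeleton.Sj c' D 1 (Skeleton.a12 χ) (Skeleton.a22 χ) +
      2 / (Skeleton.alpha D : ℂ) * Skeleton.Sj c' D 2 (Skeleton.a12 χ) (Skeleton.a22 χ) +
    3 / (2 * (Skeleton.alpha D : ℂ)) * Skeleton.Sj c' D 3 (Skeleton.a12 χ) (Skeleton.a22 χ)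

/-- `Z22:§9.u006`/`§9.u007` OBJECT: the printed coefficient `|ι₃|²b₃₃ + ι₃ῑ₄b₃₄ + ι₄ῑ₃b₄₃ + |ι₄|²b₄₄`
with `b34, b43` AS PRINTED (prefactor `0.504`). Its second reading (with `b34c, b43c`) is the tree's
`Theta1Coeff9` (Section9ChangeOfVariables) — cited, not redefined.
[cite: Zhang2022LandauSiegel, §9 p.51, tex L2628–L2629; p.52, tex L2648] -/
def coeff97 : ℂ :=
  (Complex.normSq iota3 : ℂ) * b33 + iota3 * conj iota4 * b34 + iota4 * conj iota3 * b43 +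
    (Complex.normSq iota4 : ℂ) * b44

/-- `Z22:§9.u006` CLAIM ("This yields, by substituting `x = Pᶻ`"), printed reading:
`(2α)⁻¹S₁ + 2α⁻¹S₂ + (3/(2α))S₃ = 𝔞(|ι₃|²b₃₃ + ι₃ῑ₄b₃₄ + ι₄ῑ₃b₄₃ + |ι₄|²b₄₄) + o(1)` with (9.3)–(9.6)
AS PRINTED (`coeff97`). AMBIGUITY: see `Eq95`; second reading `Step9u006c`. (At main order the tree PROVES
the `c`-reading from the u005-form: `weighted_sum_S911_main`.)
[cite: Zhang2022LandauSiegel, §9 pp.51–52, tex L2626–L2645] -/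
def Step9u006 : Prop :=
  ∀ ε : ℝ, 0 < ε → Skeleton.ForAllLarge fun D _ χ => Skeleton.AssumptionA D χ →
    ‖wsum9 c' χ - (Skeleton.frakA χ : ℂ) * coeff97‖ ≤ ε

/-- `Z22:§9.u006` CLAIM, second reading (prefactor `((0.5)(0.498)π)⁻¹` in `b₃₄, b₄₃`):
`(2α)⁻¹S₁ + 2α⁻¹S₂ + (3/(2α))S₃ = 𝔞·Theta1Coeff9 + o(1)` (`Theta1Coeff9 = |ι₃|²b33 + ι₃ῑ₄b34c + ι₄ῑ₃b43c + |ι₄|²b44`).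
[cite: Zhang2022LandauSiegel, §9 pp.51–52, tex L2626–L2645] -/
def Step9u006c : Prop :=
  ∀ ε : ℝ, 0 < ε → Skeleton.ForAllLarge fun D _ χ => Skeleton.AssumptionA D χ →
    ‖wsum9 c' χ - (Skeleton.frakA χ : ℂ) * Theta1Coeff9‖ ≤ ε

/-- `Z22:§9.u006` INFERENCE ("This yields, by substituting `x = Pᶻ`"), printed reading:
`Step9u005 ⇒ Step9u006` (uses `𝔣_{jμ}(Pᶻ) = 𝔣𝔣_{jμ}(z) + O(𝓛⁻⁸)`, `𝔤_{jμ}(Pᶻ) ≈ 𝔤𝔥_{jμ}(z)` of §8 p.49,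
`log P₃ = 0.498 log P`, `log P₂ = (0.5 − o(1))log P`, `α log P = π`). AMBIGUITY: with the printed
prefactor `0.504` of (9.5)–(9.6) this step does NOT reproduce the display's own `(log P₂)(log P₃)`;
see `Ded9u006c`. Refines `Skeleton.Ded97 c'`. CLAIM. [cite: Zhang2022LandauSiegel, §9 pp.51–52, tex L2626] -/
def Ded9u006 : Prop := Step9u005 c' → Step9u006 c'

/-- `Z22:§9.u006` INFERENCE, second reading: `Step9u005 ⇒ Step9u006c` (at main order this is the tree's
`weighted_sum_S911_main`). Refines `Skeleton.Ded97 c'`. CLAIM.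
[cite: Zhang2022LandauSiegel, §9 pp.51–52, tex L2626] -/
def Ded9u006c : Prop := Step9u005 c' → Step9u006c c'

end Constants

/-! ## Proposition 7.1 and (9.1): `Θ₁(𝐚₁₂,𝐚₂₂)` and (9.7) -/

section Evaluation

variable (c' : ℝ)

/-- `Z22:§9.u007` CLAIM ("It follows by Proposition 7.1 that"), printed reading:
`Θ₁(𝐚₁₂,𝐚₂₂) = (|ι₃|²b₃₃ + ι₃ῑ₄b₃₄ + ι₄ῑ₃b₄₃ + |ι₄|²b₄₄)𝔞𝔓 + o(𝔓)` (`Θ₁` = `Skeleton.Theta1`,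
`𝔓` = `frakP D` (2.9), `𝔞` = `Skeleton.frakA χ`). Second reading `Step9u007c`.
[cite: Zhang2022LandauSiegel, §9 p.52, tex L2646–L2649] -/
def Step9u007 : Prop :=
  ∀ ε : ℝ, 0 < ε → Skeleton.ForAllLarge fun D _ χ => Skeleton.AssumptionA D χ →
    ‖Skeleton.Theta1 c' χ (Skeleton.a12 χ) (Skeleton.a22 χ) - coeff97 * (Skeleton.frakA χ : ℂ) * (frakP D : ℂ)‖ ≤
      ε * frakP D

/-- `Z22:§9.u007` CLAIM, second reading (`b34c, b43c`): `Θ₁(𝐚₁₂,𝐚₂₂) = Theta1Coeff9·𝔞𝔓 + o(𝔓)`.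
[cite: Zhang2022LandauSiegel, §9 p.52, tex L2646–L2649] -/
def Step9u007c : Prop :=
  ∀ ε : ℝ, 0 < ε → Skeleton.ForAllLarge fun D _ χ => Skeleton.AssumptionA D χ →
    ‖Skeleton.Theta1 c' χ (Skeleton.a12 χ) (Skeleton.a22 χ) - Theta1Coeff9 * (Skeleton.frakA χ : ℂ) * (frakP D : ℂ)‖ ≤
      ε * frakP D

/-- `Z22:§9.u007` INFERENCE ("It follows by Proposition 7.1 that"): `Prop71 ∧ Step9u006 ⇒ Step9u007`
(Prop. 7.1 for `𝐚₁₂, 𝐚₂₂`, admissible by `Skeleton.adm72_a12/adm72_a22` (SkeletonReductions), with its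
`O(E(𝐚₁₂,𝐚₂₂))` absorbed into `o(𝔓)` — the manuscript's implicit claim `E(𝐚₁₂,𝐚₂₂) = o(𝔓)`, i.e.
`S_j(𝐚₁₂,𝐚₂₂) = o(𝓛⁻²)`, part of this inference). Printed reading; the `c`-reading is the same
implication with `Step9u006c`/`Step9u007c`. Refines `Skeleton.Ded97 c'` (use of `Prop71`). CLAIM.
[cite: Zhang2022LandauSiegel, §9 p.52, tex L2646] -/
def Ded9u007 : Prop := Skeleton.Prop71 c' → Step9u006 c' → Step9u007 c'

/-- `Z22:(9.7)` VARIANT (second reading of the prefactor of (9.5)–(9.6)): "`Ξ₁₂ = 𝔠₂𝔞𝔓 + o(𝔓)`" with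
`𝔠₂` = `frakc2c` (Section18Defs) in place of the printed-prefactor `frakc2` of the BANKED node
`Skeleton.Eval97 c'` (SkeletonPropositions; `Ξ₁₂` = `Skeleton.xi12`, real by (2.11)–(2.12)). Stated for the
record of the ambiguity only; `-- bridge wanted: none` (the two readings differ by a fixed constant,
`frakc2 ≠ frakc2c`: `weighted_sum_S911_add_conj`). [cite: Zhang2022LandauSiegel, §9 (9.7) p.52, tex L2651] -/
def Eval97c : Prop :=
  ∀ ε : ℝ, 0 < ε → Skeleton.ForAllLarge fun D _ χ => Skeleton.AssumptionA D χ →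
    |Skeleton.xi12 c' χ - frakc2c.re * Skeleton.frakA χ * frakP D| ≤ ε * frakP D

/-- `Z22:(9.7)` INFERENCE ("This yields"): (9.1) `∧ Step9u007 ⇒` (9.7), i.e.
`Skeleton.Eq91 c' → Step9u007 c' → Skeleton.Eval97 c'` (with `𝔠₂ = coeff97 + conj coeff97 = frakc2`,
the algebra of `Z22:§9.u008–u012`; `2Re(w𝔞𝔓) = (w + w̄)𝔞𝔓` for real `𝔞𝔓`). The last step of
`Skeleton.Ded97 c'`; printed reading. CLAIM. [cite: Zhang2022LandauSiegel, §9 (9.7) p.52, tex L2650–L2669] -/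
def Ded97last : Prop := Skeleton.Eq91 c' → Step9u007 c' → Skeleton.Eval97 c'

/-- `Z22:(9.7)` INFERENCE, second reading: `Skeleton.Eq91 c' → Step9u007c c' → Eval97c c'`
(`frakc2c = Theta1Coeff9 + conj Theta1Coeff9`: `frakc2c_eq_coeff_add_conj`, PROVED). CLAIM.
[cite: Zhang2022LandauSiegel, §9 (9.7) p.52, tex L2650–L2669] -/
def Ded97lastc : Prop := Skeleton.Eq91 c' → Step9u007c c' → Eval97c c'

end Evaluation

/-! ## The constants `𝔠₂, c₃₃, c₄₄, c₃₄, c₄₃`, the printed numerics, and (9.8) -/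

section Numerics

/-- `Z22:§9.u008` CLAIM (definitional display "where"): "`𝔠₂ = |ι₃|²c₃₃ + ι₃ῑ₄c₃₄ + ι₄ῑ₃c₄₃ + |ι₄|²c₄₄`"
(banked `frakc2`, Section18Defs, printed-prefactor `c₃₄, c₄₃`; holds by `rfl`; second reading `frakc2c`).
[cite: Zhang2022LandauSiegel, §9 p.52, tex L2654–L2655] -/
def Step9u008 : Prop :=
  frakc2 = (Complex.normSq iota3 : ℂ) * c33 + iota3 * conj iota4 * c34 + iota4 * conj iota3 * c43 +
    (Complex.normSq iota4 : ℂ) * c44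

/-- `Z22:§9.u009` CLAIM (definitional display "with"): "`c₃₃ = b₃₃ + conj b₃₃`" (banked `c33`; `rfl`).
[cite: Zhang2022LandauSiegel, §9 p.52, tex L2658–L2659] -/
def Step9u009 : Prop := c33 = b33 + conj b33

/-- `Z22:§9.u010` CLAIM (definitional display): "`c₄₄ = c₂₂`" (`c22 = b22 + conj b22` of §8 p.50;
banked `c44 := c22`; `rfl`). [cite: Zhang2022LandauSiegel, §9 p.52, tex L2661–L2662] -/
def Step9u010 : Prop := c44 = c22

/-- `Z22:§9.u011` CLAIM (definitional display): "`c₃₄ = b₃₄ + conj b₄₃`" (banked `c34`, printed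
prefactor; second reading `c34c = b34c + conj b43c`; `rfl`). [cite: Zhang2022LandauSiegel, §9 p.52, tex L2664–L2665] -/
def Step9u011 : Prop := c34 = b34 + conj b43

/-- `Z22:§9.u012` CLAIM (definitional display): "`c₄₃ = conj c₃₄`" (banked `c43`; `rfl`).
[cite: Zhang2022LandauSiegel, §9 p.52, tex L2667–L2668] -/
def Step9u012 : Prop := c43 = conj c34

/-- `Z22:§9.u013` NUMERICAL CLAIM AS PRINTED ("Numerical calculation shows that"):
"`c₃₃ = 3.69507 + ε/2`", `ε` a complex number with `|ε| < 10⁻⁵` (§8 p.50, tex L2570) — i.e.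
`‖c₃₃ − 3.69507‖ < 5·10⁻⁶`. Typed, not asserted (the num lane certifies; tree certificate of record:
`c33_re_bounds : 3.695072 < Re c₃₃ < 3.695073`, `c33_im : Im c₃₃ = 0`, Section18Certificate; `c₃₃` does
not involve the ambiguous prefactor). [cite: Zhang2022LandauSiegel, §9 p.52, tex L2670–L2673] -/
def Step9u013 : Prop := ∃ e : ℂ, ‖e‖ < 1e-5 ∧ c33 = ((3.69507 : ℝ) : ℂ) + e / 2

/-- `Z22:§9.u014` NUMERICAL CLAIM AS PRINTED: "`c₃₄ = −0.4526 + 0.19474i + ε/√2`", `|ε| < 10⁻⁵`, for the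
printed-prefactor `c34` (Section18Defs). Typed, not asserted. Certificates of record (Section18Certificate):
`c34_re_bounds : −0.449013 < Re c34 < −0.449012`, `c34_im_bounds` (the printed-prefactor object differs
from the printed value by ≈ 3.6·10⁻³), while the `((0.5)(0.498)π)⁻¹` reading matches:
`c34c_re_bounds : −0.452605 < Re c34c < −0.452604`, `c34c_im_bounds : 0.194741 < Im c34c < 0.194742`
— see `Step9u014c`. [cite: Zhang2022LandauSiegel, §9 p.52, tex L2674–L2676] -/
def Step9u014 : Prop :=
  ∃ e : ℂ, ‖e‖ < 1e-5 ∧ c34 = ((-0.4526 : ℝ) : ℂ) + ((0.19474 : ℝ) : ℂ) * I + e / ((Real.sqrt 2 : ℝ) : ℂ)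

/-- `Z22:§9.u014` NUMERICAL CLAIM, second reading: the same printed value for `c34c`
(`= b34c + conj b43c`, prefactor `((0.5)(0.498)π)⁻¹`). Typed, not asserted.
[cite: Zhang2022LandauSiegel, §9 p.52, tex L2674–L2676] -/
def Step9u014c : Prop :=
  ∃ e : ℂ, ‖e‖ < 1e-5 ∧ c34c = ((-0.4526 : ℝ) : ℂ) + ((0.19474 : ℝ) : ℂ) * I + e / ((Real.sqrt 2 : ℝ) : ℂ)

/-- `Z22:(9.8)` INFERENCE ("It follows that `𝔠₂ < 6.9955`"): from the definitions `Z22:§9.u008–u012`, the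
printed numerics `Step9u013`, `Step9u014`, the value of `c₂₂` from §8 (`c₂₂ = 1.32215 + ε/2`, p.50, tex
L2576 — node `Z22:§8.u062`, typed by adj-1 as `PrintedC22` in `Section8PrintedConstants` (p411778, pending at
the time of writing; an explicit hypothesis for a discharger, not restated here) and `ι₃, ι₄` of (2.26), the
inequality (9.8), BANKED as
`Ineq98 : frakc2.re < 6.9955` (Section18Defs; `Re` since `𝔠₂` is real, `frakc2_im`). (9.8) itself is
TRUE in the tree under both prefactor readings (`ineq98`, `ineq98c`, Section18Certificate:
`𝔠₂ = 6.99491…`, resp. `6.98709…`); this decl types only the printed inference. CLAIM.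
[cite: Zhang2022LandauSiegel, §9 (9.8) p.52, tex L2677–L2680] -/
def Ded98 : Prop := Step9u013 → Step9u014 → Ineq98

end Numerics

end Literature.NumberTheory.LFunctions.Zhang2022.Section9Statements

end
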